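import Literature.Analysis.FluidPDE.Seregin2023.TypeIIEulerZoom
import Literature.Analysis.FluidPDE.SuitableWeakSliced
import Literature.Analysis.FluidPDE.Seregin2020AxisymmetricTypeII
import HarnessLib

/-!
# Seregin 2023/2026: the Type II blow-up SCENARIO — its scale-covariant quantities, the
# exclusion theorem (Thm 2.1) and the Euler-zoom limit theorem (Thm 3.1)

Statements-first typing (D-0014 named facts, D-0064 one file per source section) of the part of
G. Seregin, *On potential Type II blowups for the Navier–Stokes equations*, arXiv:2606.29468
(2026) [`Seregin2026`] that the sibling file `TypeIIEulerZoom.lean` lists under "Deliberately not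
here": the scenario quantities `M^{s,l}_κ`, `A_f`, `E_f`, `D_f` over suitable weak solutions in the
unit parabolic cylinder `Q`, and the two theorems of §§2–3. The earlier polynomial scenario of
G. Seregin, *Remarks on Type II blowups of solutions to the Navier–Stokes equations*,
arXiv:2304.04045 = Commun. Pure Appl. Anal. 23 (2024) [`Seregin2023`, `Seregin2024`], (1.8)–(1.9),
is the case `f(r) = r^{1-m}`, `g(r) = r^{κ(1-m₀)}` ([Seregin2026] p. 3 "In papers [4]-[6], the
function `g` has a polynomial character: `g(r) = r^{κ(1-m₀)}`", p. 4 "`f(r) = r^{1-m}`"). Page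
numbers are arXiv PDF pages. Filed by the §B (Type-II-exclusion) consumer-side typer of cell
`ns-regularity-ideate`; nothing here is new mathematics and nothing here bears on regularity.

## What is typed (all at the space–time origin `z = 0`, as printed; time first, `ℝ³ = EuclideanSpace ℝ (Fin 3)`)

* [Seregin2026] (1.1) p. 2: `g₀(v) = min{liminf_{r→0} A, liminf_{r→0} E, liminf_{r→0} C}`, "Type I
  blowup if `g₀(v) < ∞` and … Type II blowup if `g₀(v) = ∞`" (p. 3) — `blowupIndexInf`, with
  `blowupIndexInf_le_blowupIndex` (it is dominated by Seregin's 2020 index `g = min limsup`,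
  `Seregin2020.blowupIndex`, so a 2026-Type-II point is a 2020-Type-II point:
  `isTypeIIAt_of_blowupIndexInf_eq_top`).
* [Seregin2026] (1.4) p. 3: `κ = κ(s,l) = l (3/s + 2/l - 1)` — `kappa`; p. 3:
  `M^{s,l}_κ(v, a) = a^{-κ} ∫_{-a²}^0 (∫_{B(a)} |v|^s dx)^{l/s} dt` — `morreyM` (any centre `z`);
  §3 p. 8: `M̄^{s,l}_κ(v, r)` (time window `]-r² f(r), 0[`) — `morreyMbar`.
* [Seregin2026] (1.7) p. 4: `A_f(v,r) = sup_{-r²<t<0} f²(r)/r ∫_{B(r)} |v|²`,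
  `E_f(v,r) = f(r)/r ∫_{Q(r)} |∇v|²`, `D_f(q,r) = f²(r)/r² ∫_{Q(r)} |q|^{3/2}` — `weightedA`
  (ESSENTIAL supremum in `t`, see Rendering), `weightedE`, `weightedD`; with `f ≡ 1` these are
  Albritton–Barker's `A` (`cknAEss`) and the CKN quantities `cknE`, `cknD` (`weightedA_one`, …).
* [Seregin2026] p. 4 + (2.2) p. 5: the admissible weights `f : ]0,1] → ]0,1]` increasing,
  `f(0+) = 0`, `f(1) = 1`, with `F(a) = liminf_{λ→0} f(λa)/f(λ) > 0` — `IsScenarioWeight f F`.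
* [Seregin2026] (2.1) p. 5: `1/p(η) = η/6 + 3(1-η)/10`, `1/q(η) = η/2 + 3(1-η)/10` — `pEta`,
  `qEta`, with the printed check `3/p(η) + 2/q(η) - 1 = 1/2` (`three_div_pEta_add_two_div_qEta`).
* **Theorem 2.1** p. 5 (exclusion of scenario (1.3) ∧ (1.7)) — named fact
  `seregin2026_typeII_scenario_excluded`.
* **Theorem 3.1** p. 9 (scenario (3.1) ∧ (1.7) ∧ (3.3) ⇒ a non-trivial ancient weak Euler
  solution on `Q₋ = ℝ³ × ]-∞, 0[` in the weighted class (3.5)) — named fact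
  `seregin2026_typeII_scenario_eulerLimit`.

## Rendering (each deviation from the letter goes in the SAFE direction)

* "Suitable weak solution in `Q`" (p. 2: `v ∈ L_∞(-1,0;L₂(B))`, `∇v ∈ L₂(Q)`, `q ∈ L_{3/2}(Q)`,
  Navier–Stokes in distributions, local energy inequality for a.a. `t`; `ν = 1`, no force) is the
  accepted Albritton–Barker/Lin class `IsSuitableWeakSolutionInBall 1 0 v q` (`LocalTypeI.lean`) on
  `Q = Q(0, 1) = ]-1, 0[ × B(1)` (`parabolicCylinder 1 0`), exactly as in the Seregin 2020 file
  (`Seregin2020AxisymmetricTypeII.lean`); `∇v` is represented by a weak spatial gradient `G` on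
  `Q` (`HasWeakSpatialGradientOn`; two such agree a.e., so `E_f` does not depend on the choice).
* `A_f` and the first term of (3.5): the printed `sup_{-r²<t<0}` of an `L_∞(L₂)` quantity is an
  ESSENTIAL supremum (as in Albritton–Barker's `A`, `cknAEss`); using `ess sup` in the HYPOTHESIS
  (1.7) is the faithful (weaker-than-`sup`) reading and in the CONCLUSION (3.5) it is the weaker,
  hence safe, one (cf. the `SereginZhou2020` verdict on genuine suprema of a.e.-defined fields).
* "`f` monotonically increasing" is rendered as `StrictMonoOn f (Ioc 0 1)` (stronger hypothesis ⇒
  weaker fact); (2.2) "there is a limit `F(a) = liminf_{λ→0} f(λa)/f(λ) > 0`" as: `F a` is a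
  positive real and the `ℝ≥0∞`-valued lower limit of `f(λa)/f(λ)` along `λ → 0⁺` equals it.
* `g : ]0,1[ → ]0,∞[` (p. 3): `0 < g r` on `Ioo 0 1`. (2.4)/(2.5)/(3.3) are `Filter.Tendsto` /
  eventual bounds along `𝓝[>] 0`; (2.5) is stated in `ℝ≥0∞` (`ofReal (g r) * M(v,r) → 0`), which
  for the finite `M` of the paper is the printed `g(r) M(v,r) → 0`.
* (3.1): `r_k ↓ 0` = a strictly decreasing sequence in `]0,1[` tending to `0`; `g(r) = f(r)^{l-1}`.
* Conclusion of Thm 3.1: (3.6) "in the sense of distributions" = the accepted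
  `IsDistributionalEulerSolutionOn` on the slab `]-∞,0[ × ℝ³` (pressure-explicit, weakly
  divergence free); (3.7) verbatim in the a.e.-sliced form with the accepted integrand
  `localEnergyRHS 0 0 u p φ` (= `|u|² ∂_τφ + u·∇φ (|u|² + 2p)` for `ν = 0`, no force), the test
  function quantified OUTSIDE the a.e. set (weaker ⇒ safe); (3.5) with `ess sup`; (3.8)
  `M^{s,l}_κ(u, 1) ≥ ε₀/2` in `ℝ≥0∞`.
* Standing restrictions carried explicitly: `1 < s`, `1 < l`, `0 < κ < l` ((1.4)),
  `0 ≤ η ≤ 1`, `s < p(η)`, `l < q(η)` ((2.3)); Thm 3.1 is stated under (1.4) ∧ (2.3) as well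
  ("repeating the same arguments as in the proof of Proposition 1.2 in [4]", p. 9; (3.3) involves
  `p(η)`), and both theorems carry §2's standing assumption (2.2) on `f`.

## Deliberately not here

The proofs (compactness of the scaled sequence, pp. 6–7); the worked examples (2.10), (3.9)–(3.11)
(the energy-Liouville case `2α - 3 > 0` is `TypeIIEulerZoom.lean`'s
`ae_eq_zero_of_scaledLocalEnergyBound`); §4 (axisymmetric case, Prop. 4.1 — topic of the A4
axisymmetric harvest); Theorem 1.1 and Appendices I–III of [Seregin2023]; Proposition 1.2 of
[Seregin2023] as a separate fact (it is the polynomial instance `f = r^{1-m}`, `g = r^{κ(1-m₀)}` of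
the scenario, whose (1.3)-form Theorem 2.1 addresses; a kernel-checked reduction is left to a
proof-only sequel so that this file adds no further named fact).

## Mathlib / tree search

`lean search` for `morrey|Morrey.*kappa|weightedA|M_kappa|scenario|2606.29468|Seregin2026`: only
`TypeIIEulerZoom.lean` (Euler scaling, `HasScaledLocalEnergyBound` = first clause of (1.13)/(3.5)
with `F(a) = a^{α-1}`) and docstring mentions in Summits files; no typing of Thms 2.1/3.1. Reused:
`cknA/cknE/cknC/cknD`, `parabolicCylinder(Opens)`, `IsSuitableWeakSolutionOn`,
`HasWeakSpatialGradientOn`, `IsDistributionalEulerSolutionOn`, `slab`, `IsSpaceTimeTestOn`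
(`SuitableWeak.lean`, `WeakSolution.lean`), `cknAEss`, `IsSuitableWeakSolutionInBall`,
`IsBackwardSingularPoint` (`LocalTypeI.lean`, via `Seregin2020AxisymmetricTypeII.lean`, which
also supplies `Seregin2020.blowupIndex`, `Seregin2020.IsTypeIIAt`), `localEnergyRHS`
(`SuitableWeakSliced.lean`).
-/

noncomputable section

open _root_.MeasureTheory _root_.Set _root_.Filter _root_.Metric _root_.Function
  _root_.TopologicalSpace
open scoped _root_.ENNReal _root_.NNReal _root_.Topology

namespace Literature.Analysis.FluidPDE.Seregin2023

/-! ## The 2026 blow-up index `g₀` (min of lower limits) -/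

section Index

variable {E : Type*} [NormedAddCommGroup E] [InnerProductSpace ℝ E] [FiniteDimensional ℝ E]
  [MeasurableSpace E] [BorelSpace E]

/-- **Seregin's 2026 blow-up index** `g₀(v) = min{liminf_{r→0} A(v,r), liminf_{r→0} E(v,r),
liminf_{r→0} C(v,r)} ∈ [0, ∞]` at the space–time point `z₀` ([Seregin2026] (1.1) p. 2), over the
accepted CKN scaled quantities `cknA`, `cknE` (`G` standing for `∇v`), `cknC` on the backward
parabolic balls `Q(z₀, r)`, lower limits along `r → 0⁺`. "`z = 0` is a Type I blowup if
`g₀(v) < ∞` and `z = 0` is Type II blowup if `g₀(v) = ∞`" (p. 3). Compare Seregin 2020, Def. 1.7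
(`Seregin2020.blowupIndex`: minimum of UPPER limits). [cite: Seregin2026, (1.1) (p. 2) and p. 3] -/
def blowupIndexInf (z₀ : ℝ × E) (v : ℝ → E → E) (G : ℝ → E → E →L[ℝ] E) : ℝ≥0∞ :=
  min (liminf (fun r => cknA r z₀ v) (𝓝[>] 0))
    (min (liminf (fun r => cknE r z₀ G) (𝓝[>] 0)) (liminf (fun r => cknC r z₀ v) (𝓝[>] 0)))

/-- `g₀ = ∞` — "Type II blowup" in the 2026 sense — iff all three lower limits are infinite
(unfolding of (1.1)). [cite: Seregin2026, (1.1) (p. 2) and p. 3] -/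
theorem blowupIndexInf_eq_top_iff {z₀ : ℝ × E} {v : ℝ → E → E} {G : ℝ → E → E →L[ℝ] E} :
    blowupIndexInf z₀ v G = ∞ ↔
      liminf (fun r => cknA r z₀ v) (𝓝[>] 0) = ∞ ∧ liminf (fun r => cknE r z₀ G) (𝓝[>] 0) = ∞ ∧
        liminf (fun r => cknC r z₀ v) (𝓝[>] 0) = ∞ := by
  simp only [blowupIndexInf, min_eq_top]

/-- The 2026 index (lower limits, [Seregin2026] (1.1)) is dominated by Seregin's 2020 index
(upper limits, Seregin 2020 Def. 1.7 = `Seregin2020.blowupIndex`): `g₀ ≤ g` (`liminf ≤ limsup`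
termwise). [cite: Seregin2026, (1.1) (p. 2); cf. Seregin2020, Def. 1.7] -/
theorem blowupIndexInf_le_blowupIndex (z₀ : ℝ × E) (v : ℝ → E → E) (G : ℝ → E → E →L[ℝ] E) :
    blowupIndexInf z₀ v G ≤ Seregin2020.blowupIndex z₀ v G := by
  unfold blowupIndexInf Seregin2020.blowupIndex
  have hA := liminf_le_limsup (f := 𝓝[>] (0 : ℝ)) (u := fun r => cknA r z₀ v)
  have hE := liminf_le_limsup (f := 𝓝[>] (0 : ℝ)) (u := fun r => cknE r z₀ G)
  have hC := liminf_le_limsup (f := 𝓝[>] (0 : ℝ)) (u := fun r => cknC r z₀ v)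
  refine le_min ?_ (le_min ?_ ?_)
  · exact (min_le_right _ _).trans ((min_le_left _ _).trans hE)
  · exact (min_le_left _ _).trans hA
  · exact (min_le_right _ _).trans ((min_le_right _ _).trans hC)

/-- Hence a singular point which is Type II in the 2026 sense (`g₀ = ∞`) is Type II in the sense
of Seregin 2020, Def. 1.7 (`Seregin2020.IsTypeIIAt`: backward singular point with `g = ∞`).
[cite: Seregin2026, p. 3 (Type II: `g₀ = ∞`); cf. Seregin2020, Def. 1.7] -/
theorem isTypeIIAt_of_blowupIndexInf_eq_top {z₀ : ℝ × EuclideanSpace ℝ (Fin 3)}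
    {v : ℝ → EuclideanSpace ℝ (Fin 3) → EuclideanSpace ℝ (Fin 3)}
    {G : ℝ → EuclideanSpace ℝ (Fin 3) → EuclideanSpace ℝ (Fin 3) →L[ℝ] EuclideanSpace ℝ (Fin 3)}
    (hsing : IsBackwardSingularPoint v z₀) (h : blowupIndexInf z₀ v G = ∞) :
    Seregin2020.IsTypeIIAt z₀ v G :=
  ⟨hsing, top_le_iff.mp (h ▸ blowupIndexInf_le_blowupIndex z₀ v G)⟩

end Index

/-! ## The scenario quantities `κ`, `M^{s,l}_κ`, `M̄^{s,l}_κ`, `A_f`, `E_f`, `D_f` -/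

section Quantities

variable {E : Type*} [NormedAddCommGroup E] [InnerProductSpace ℝ E] [FiniteDimensional ℝ E]
  [MeasurableSpace E] [BorelSpace E]
  {F : Type*} [NormedAddCommGroup F]

/-- The exponent `κ = κ(s, l) = l (3/s + 2/l - 1)` of [Seregin2026] (1.4) p. 3 (= [Seregin2023]
(1.2)): the power of the radius making `M^{s,l}_κ` invariant under the Navier–Stokes scaling.
[cite: Seregin2026, (1.4) (p. 3)] -/
def kappa (s l : ℝ) : ℝ :=
  l * (3 / s + 2 / l - 1)

/-- `κ(s,l) = 3l/s + 2 - l` for `l ≠ 0` (expanded form of (1.4)). [cite: Seregin2026, (1.4) (p. 3)] -/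
theorem kappa_eq (s : ℝ) {l : ℝ} (hl : l ≠ 0) : kappa s l = 3 * l / s + 2 - l := by
  unfold kappa
  field_simp

/-- **The scenario quantity** `M^{s,l}_κ(v, a) = a^{-κ} ∫_{t₀-a²}^{t₀} (∫_{B(x₀,a)} |v(x,t)|^s dx)^{l/s} dt`
at the space–time centre `z = (t₀, x₀)` ([Seregin2026] p. 3, display after (1.3), printed at
`z = 0`; [Seregin2023] (1.2)), in `ℝ≥0∞`, the powers being real powers. Intended for `a > 0`,
`s, l ≥ 1`. [cite: Seregin2026, §1 p. 3 (display after (1.3))] -/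
def morreyM (κ s l : ℝ) (z : ℝ × E) (v : ℝ → E → F) (a : ℝ) : ℝ≥0∞ :=
  ENNReal.ofReal (a ^ (-κ)) *
    ∫⁻ t in Ioo (z.1 - a ^ 2) z.1, (∫⁻ x in ball z.2 a, ‖v t x‖ₑ ^ s) ^ (l / s)

/-- **The modified scenario quantity of §3**
`M̄^{s,l}_κ(v, r) = r^{-κ} ∫_{t₀-r²f(r)}^{t₀} (∫_{B(x₀,r)} |v|^s dx)^{l/s} dt` — the same as
`M^{s,l}_κ` but over the shorter time window `]t₀ - r² f(r), t₀[` ([Seregin2026] §3 p. 8,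
printed at `z = 0`); `M^{s,l}_κ(v,r) ≥ M̄^{s,l}_κ(v,r)` when `f(r) ≤ 1` ((3.2),
`morreyMbar_le_morreyM`). [cite: Seregin2026, §3 p. 8 (display after (3.1))] -/
def morreyMbar (f : ℝ → ℝ) (κ s l : ℝ) (z : ℝ × E) (v : ℝ → E → F) (r : ℝ) : ℝ≥0∞ :=
  ENNReal.ofReal (r ^ (-κ)) *
    ∫⁻ t in Ioo (z.1 - r ^ 2 * f r) z.1, (∫⁻ x in ball z.2 r, ‖v t x‖ₑ ^ s) ^ (l / s)

/-- (3.2): `M̄^{s,l}_κ(v, r) ≤ M^{s,l}_κ(v, r)` as soon as `f(r) ≤ 1` (the time window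
`]t₀ - r²f(r), t₀[` is contained in `]t₀ - r², t₀[`). [cite: Seregin2026, (3.2) (p. 8)] -/
theorem morreyMbar_le_morreyM {f : ℝ → ℝ} {κ s l : ℝ} {z : ℝ × E} {v : ℝ → E → F} {r : ℝ}
    (hf1 : f r ≤ 1) : morreyMbar f κ s l z v r ≤ morreyM κ s l z v r := by
  unfold morreyMbar morreyM
  refine mul_le_mul_right (lintegral_mono_set (Ioo_subset_Ioo ?_ le_rfl)) _
  nlinarith [sq_nonneg r]

/-- **Weighted scaled energy** `A_f(v, r) = ess sup_{t₀-r²<t<t₀} f²(r)/r ∫_{B(x₀,r)} |v(x,t)|² dx`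
([Seregin2026] (1.7) p. 4, printed at `z = 0` with `sup`; the supremum of this `L_∞(L₂)`-quantity
is rendered as the ESSENTIAL supremum in `t`, cf. the module docstring), in `ℝ≥0∞`. With `f ≡ 1`
this is Albritton–Barker's `A` (`weightedA_one`). [cite: Seregin2026, (1.7) (p. 4)] -/
def weightedA (f : ℝ → ℝ) (r : ℝ) (z : ℝ × E) (v : ℝ → E → F) : ℝ≥0∞ :=
  essSup (fun t => ENNReal.ofReal (f r ^ 2 / r) * ∫⁻ x in ball z.2 r, ‖v t x‖ₑ ^ 2)
    (volume.restrict (Ioo (z.1 - r ^ 2) z.1))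

/-- **Weighted scaled dissipation** `E_f(v, r) = f(r)/r ∫_{Q(z,r)} |∇v|² dz` ([Seregin2026] (1.7)
p. 4, printed at `z = 0`), `∇v` represented by a (weak) spatial gradient `G`, `|∇v|²` the squared
Frobenius norm; in `ℝ≥0∞`. With `f ≡ 1` this is `cknE` (`weightedE_one`).
[cite: Seregin2026, (1.7) (p. 4)] -/
def weightedE (f : ℝ → ℝ) (r : ℝ) (z : ℝ × E) (G : ℝ → E → E →L[ℝ] E) : ℝ≥0∞ :=
  ENNReal.ofReal (f r / r) *
    ∫⁻ w in parabolicCylinder r z, ENNReal.ofReal (frobeniusNormSq (G w.1 w.2))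

/-- **Weighted scaled pressure** `D_f(q, r) = f²(r)/r² ∫_{Q(z,r)} |q|^{3/2} dz` ([Seregin2026]
(1.7) p. 4, printed at `z = 0`), in `ℝ≥0∞`. With `f ≡ 1` this is `cknD` (`weightedD_one`).
[cite: Seregin2026, (1.7) (p. 4)] -/
def weightedD (f : ℝ → ℝ) (r : ℝ) (z : ℝ × E) (q : ℝ → E → ℝ) : ℝ≥0∞ :=
  ENNReal.ofReal (f r ^ 2 / r ^ 2) *
    ∫⁻ w in parabolicCylinder r z, ‖q w.1 w.2‖ₑ ^ (3 / 2 : ℝ)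

/-- With the trivial weight `f ≡ 1`, `A_f` is the unweighted scaled energy `A` of [Seregin2026]
p. 2 in its essential-supremum form, i.e. Albritton–Barker's `A(Q(z,r))` (`cknAEss`), `r > 0`.
[cite: Seregin2026, (1.7) (p. 4) and p. 2 (definition of `A`)] -/
theorem weightedA_one {r : ℝ} (hr : 0 < r) (z : ℝ × EuclideanSpace ℝ (Fin 3))
    (v : ℝ → EuclideanSpace ℝ (Fin 3) → EuclideanSpace ℝ (Fin 3)) :
    weightedA (fun _ => (1 : ℝ)) r z v = cknAEss r z v := by
  unfold weightedA cknAEss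
  rw [one_pow, one_div, ENNReal.ofReal_inv_of_pos hr]

/-- With `f ≡ 1`, `E_f` is the unweighted scaled dissipation `E` of [Seregin2026] p. 2 (`cknE`),
`r > 0`. [cite: Seregin2026, (1.7) (p. 4) and p. 2 (definition of `E`)] -/
theorem weightedE_one {r : ℝ} (hr : 0 < r) (z : ℝ × E) (G : ℝ → E → E →L[ℝ] E) :
    weightedE (fun _ => (1 : ℝ)) r z G = cknE r z G := by
  unfold weightedE cknE
  rw [one_div, ENNReal.ofReal_inv_of_pos hr]

/-- With `f ≡ 1`, `D_f` is the unweighted scaled pressure quantity `D` (`cknD`; [Seregin2023]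
p. 3, `E(r) = E + A + D(q,r)`), `r > 0`. [cite: Seregin2026, (1.7) (p. 4); Seregin2023, p. 3 (`D(q,r)`)] -/
theorem weightedD_one {r : ℝ} (hr : 0 < r) (z : ℝ × E) (q : ℝ → E → ℝ) :
    weightedD (fun _ => (1 : ℝ)) r z q = cknD r z q := by
  unfold weightedD cknD
  rw [one_pow, one_div, ENNReal.ofReal_inv_of_pos (pow_pos hr 2), ENNReal.ofReal_pow hr.le]

end Quantities

/-! ## The admissible weights `f`, `F` and the exponents `p(η)`, `q(η)` -/

section Weights

/-- **Admissible scenario weights** ([Seregin2026] p. 4 after (1.7) and (2.2) p. 5):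
`f : ]0,1] → ]0,1]` is monotonically increasing (rendered: strictly, on `]0,1]`) with
`lim_{λ→0} f(λ) = 0`, `f(1) = 1`, and for every `0 < a < ∞` "there is a limit
`F(a) = liminf_{λ→0} F_λ(a) > 0`, `F_λ(a) = f(λa)/f(λ)`" — rendered: `F a` is a positive real
number and the lower limit, taken in `ℝ≥0∞` along `λ → 0⁺`, of `f(λa)/f(λ)` equals `F a`.
(In [Seregin2023] `f(r) = r^{1-m}`, `F(a) = a^{1-m}`; in the examples (2.10), (3.9) of
[Seregin2026] `F ≡ 1`, resp. `F(a) = a^{α-1}`.) [cite: Seregin2026, §1 p. 4 (after (1.7)) and (2.2) (p. 5)] -/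
structure IsScenarioWeight (f F : ℝ → ℝ) : Prop where
  /-- `f` is (strictly) increasing on `]0, 1]`. -/
  strictMonoOn : StrictMonoOn f (Ioc (0 : ℝ) 1)
  /-- `f` maps `]0, 1]` into `]0, 1]`. -/
  mapsTo : ∀ r ∈ Ioc (0 : ℝ) 1, f r ∈ Ioc (0 : ℝ) 1
  /-- `f(1) = 1`. -/
  map_one : f 1 = 1
  /-- `f(λ) → 0` as `λ → 0⁺`. -/
  tendsto_zero : Tendsto f (𝓝[>] 0) (𝓝 0)
  /-- `F(a) > 0` for every `a > 0`. -/
  pos : ∀ a : ℝ, 0 < a → 0 < F a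
  /-- `F(a) = liminf_{λ→0⁺} f(λa)/f(λ)` (lower limit in `ℝ≥0∞`). -/
  liminf_eq : ∀ a : ℝ, 0 < a →
    liminf (fun lam => ENNReal.ofReal (f (lam * a) / f lam)) (𝓝[>] 0) = ENNReal.ofReal (F a)

/-- **Power weights are admissible**: for `θ > 0`, `f(r) = r^θ` is a scenario weight with limit
ratio `F(a) = a^θ` (`f(λa)/f(λ) = a^θ` identically). This covers [Seregin2023]'s `f(r) = r^{1-m}`
(`θ = 1 - m = α - 1 > 0`, `F(a) = a^{α-1}`, cf. [Seregin2026] (3.9)–(3.10) with `γ = 0`) and shows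
that `IsScenarioWeight` is not vacuous. [cite: Seregin2026, §1 p. 4 (`f(r) = r^{1-m}`) and (3.9)–(3.10) (p. 10, `γ = 0`)] -/
theorem isScenarioWeight_rpow {θ : ℝ} (hθ : 0 < θ) :
    IsScenarioWeight (fun r => r ^ θ) (fun a => a ^ θ) where
  strictMonoOn := fun a ha b _ hab => Real.rpow_lt_rpow ha.1.le hab hθ
  mapsTo := fun r hr =>
    ⟨Real.rpow_pos_of_pos hr.1 θ, Real.rpow_le_one hr.1.le hr.2 hθ.le⟩
  map_one := Real.one_rpow θ
  tendsto_zero := by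
    have h := (Real.continuousAt_rpow_const 0 θ (Or.inr hθ.le)).tendsto
    rw [Real.zero_rpow hθ.ne'] at h
    exact h.mono_left nhdsWithin_le_nhds
  pos := fun a ha => Real.rpow_pos_of_pos ha θ
  liminf_eq := by
    intro a ha
    have hev : ∀ᶠ lam in 𝓝[>] (0 : ℝ),
        ENNReal.ofReal ((lam * a) ^ θ / lam ^ θ) = ENNReal.ofReal (a ^ θ) := by
      filter_upwards [self_mem_nhdsWithin] with lam hlam
      have hl : 0 < lam := hlam
      rw [Real.mul_rpow hl.le ha.le, mul_comm, mul_div_assoc,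
        div_self (Real.rpow_pos_of_pos hl θ).ne', mul_one]
    rw [liminf_congr hev, liminf_const]

/-- The exponent `p(η)`, `1/p(η) = η/6 + 3(1-η)/10`, `0 ≤ η ≤ 1` ([Seregin2026] (2.1) p. 5 =
[Seregin2023] (1.11) with `λ` for `η`); `p` runs from `10/3` (`η = 0`) to `6` (`η = 1`).
[cite: Seregin2026, (2.1) (p. 5)] -/
def pEta (η : ℝ) : ℝ :=
  (η / 6 + 3 * (1 - η) / 10)⁻¹

/-- The exponent `q(η)`, `1/q(η) = η/2 + 3(1-η)/10`, `0 ≤ η ≤ 1` ([Seregin2026] (2.1) p. 5);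
`q` runs from `10/3` (`η = 0`) to `2` (`η = 1`). [cite: Seregin2026, (2.1) (p. 5)] -/
def qEta (η : ℝ) : ℝ :=
  (η / 2 + 3 * (1 - η) / 10)⁻¹

/-- "It is easy to check that `1 > 3/p(η) + 2/q(η) - 1 = 1/2 > 0` for all `0 ≤ η ≤ 1`"
([Seregin2026] p. 5): the pair `(p(η), q(η))` sits on the line `3/p + 2/q = 3/2`.
[cite: Seregin2026, §2 p. 5 (after (2.1))] -/
theorem three_div_pEta_add_two_div_qEta (η : ℝ) : 3 / pEta η + 2 / qEta η - 1 = 1 / 2 := by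
  unfold pEta qEta
  rw [div_inv_eq_mul, div_inv_eq_mul]
  ring

end Weights

/-! ## The scenario bound (1.7) and the two theorems -/

section Scenario

/-- **The second scenario assumption (1.7)** of [Seregin2026] p. 4, with an explicit bound:
`A_f(v, r) + E_f(v, r) + D_f(q, r) ≤ M₁` for all `0 < r < 1` (the paper:
`M₁ = sup_{0<r<1} {A_f + E_f + D_f} < ∞`), the quantities taken at the origin `z = 0` of the unit
cylinder `Q`; `G` stands for `∇v`. For `f(r) = r^{1-m}` this is [Seregin2023] (1.9)
(`A_{m₁} + D_m + E_m ≤ c`, `m₁ = 2m - 1`). [cite: Seregin2026, (1.7) (p. 4)] -/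
def HasWeightedEnergyBound (f : ℝ → ℝ) (M₁ : ℝ≥0)
    (v : ℝ → EuclideanSpace ℝ (Fin 3) → EuclideanSpace ℝ (Fin 3))
    (q : ℝ → EuclideanSpace ℝ (Fin 3) → ℝ)
    (G : ℝ → EuclideanSpace ℝ (Fin 3) → EuclideanSpace ℝ (Fin 3) →L[ℝ] EuclideanSpace ℝ (Fin 3)) :
    Prop :=
  ∀ r ∈ Ioo (0 : ℝ) 1,
    weightedA f r (0 : ℝ × EuclideanSpace ℝ (Fin 3)) v +
        weightedE f r (0 : ℝ × EuclideanSpace ℝ (Fin 3)) G +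
        weightedD f r (0 : ℝ × EuclideanSpace ℝ (Fin 3)) q ≤ M₁

/-- **Seregin 2026, Theorem 2.1 (the Type II scenario (1.3) ∧ (1.7) is impossible).**
"Let a pair `v` and `q` be a suitable weak solution to the Navier–Stokes equations in `Q`. It is
supposed that this pair obeys condition (1.7). Assume further that, for some numbers `s` and `l`,
satisfying inequalities (1.4) [`l > κ := l(3/s + 2/l - 1) > 0`, `s > 1`, `l > 1`], the additional
restrictions `s < p(η)`, `l < q(η)` (2.3) hold with some parameter `0 ≤ η ≤ 1`. Suppose also that
`(f(λ))^{(l/2)(1+3/s) - (3/2)(1 - s/p(η))(l/s)} (g(λ√f(λ)))^{-1} → ∞` as `λ → 0` (2.4). Then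
`lim_{r→0} g(r) M^{s,l}_κ(v, r) = 0` (2.5). In other words, scenario (1.3) and (1.7) of potential
Type II blowup is impossible." Here `g : ]0,1[ → ]0,∞[` is the rate function of the first scenario
assumption (1.2)–(1.3) (`g(r_k) → 0`, `g(r_k) M^{s,l}_κ(v,r_k) ≥ ε₀` along `r_k ↓ 0`), `f` is an
admissible weight with its limit ratio `F` (§2's standing assumption (2.2)), and the suitable
class, `A_f`/`E_f`/`D_f` (essential supremum in `A_f`) and `M^{s,l}_κ` are rendered as in the
module docstring; the conclusion is stated in `ℝ≥0∞`.

**REFUTED AS RENDERED (statement hygiene, 2026-08-27) — do not take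
`(h : seregin2026_typeII_scenario_excluded)` as a hypothesis and do not cite this constant as
Seregin's theorem.**  The admissible-weight predicate `IsScenarioWeight f F` transcribes the
printed "monotonically increasing" (p. 4) WITHOUT continuity, whereas the printed proof silently
solves `r = λ √f(λ)` for `λ` ("the choice of `λ` is as follows: `λ = λ_k`, `r_k = λ_k √f(λ_k)`",
p. 6), i.e. it needs `λ ↦ λ √f(λ)` to map onto a neighbourhood of `0`.  As typed the sentence is
FALSE in the kernel:
`Seregin2023.TypeIIScenarioCounterexample.not_seregin2026_typeII_scenario_excluded :
¬ seregin2026_typeII_scenario_excluded` (`TypeIIScenarioExcludedCounterexample.lean`: `v ≡ c`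
with `|c| = 1`, `q ≡ 0`, `G ≡ 0`, a strictly increasing weight with jumps at every dyadic scale,
`(s, l, η) = (3, 3, 0)`).  The FAITHFUL statement — this very sentence with the extra hypothesis
`ContinuousOn f (Ioc 0 1)` — is `seregin2026_typeII_scenario_excluded_continuousWeight`
(`TypeIIScenarioExcluded.lean`) and is PROVED there
(`seregin2026_typeII_scenario_excluded_continuousWeight_holds`, Seregin's own argument: zoom, the
unit-cylinder multiplicative inequality, Hölder).  Every conditional corollary of this constant
(`PolynomialScenarioExcluded.lean`: `.polynomial`, `.not_polynomialGrowth`,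
`.not_seregin2024AxisymScenario(_cknC)`, `.tendsto_cubic/cknC_seregin2025`;
`Seregin2024AxisymTypeIIScenarioReduction.lean`: `tendsto_morreyM_of_seregin2026` and the two
reductions) has an UNCONDITIONAL twin (`TypeIIScenarioExcludedConsequences.lean`,
`Seregin2024AxisymTypeIIScenarioHolds.lean`).  The constant is kept verbatim — its refutation
names it — and is to become `@[deprecated]` once those vacuous users are retired (pattern of
`SereginZhou2020.scaledEnergies_lt_top`).  The Theorem 3.1 twin below,
`seregin2026_typeII_scenario_eulerLimit`, takes `λ_k = r_k` (no inversion) and is NOT affected.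
[cite: Seregin2026, Thm 2.1 (p. 5), with (1.4), (1.7), (2.2)–(2.4) — mis-rendered (weight continuity) and refuted in-tree; faithful form proved as `…_continuousWeight_holds`] -/
def seregin2026_typeII_scenario_excluded : Prop :=
  ∀ (v : ℝ → EuclideanSpace ℝ (Fin 3) → EuclideanSpace ℝ (Fin 3))
    (q : ℝ → EuclideanSpace ℝ (Fin 3) → ℝ)
    (G : ℝ → EuclideanSpace ℝ (Fin 3) → EuclideanSpace ℝ (Fin 3) →L[ℝ] EuclideanSpace ℝ (Fin 3))
    (f F g : ℝ → ℝ) (s l η : ℝ),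
    IsSuitableWeakSolutionInBall 1 0 v q →
    HasWeakSpatialGradientOn (parabolicCylinderOpens 1 (0 : ℝ × EuclideanSpace ℝ (Fin 3))) v G →
    IsScenarioWeight f F →
    (∃ M₁ : ℝ≥0, HasWeightedEnergyBound f M₁ v q G) →
    (∀ r ∈ Ioo (0 : ℝ) 1, 0 < g r) →
    1 < s → 1 < l → 0 < kappa s l → kappa s l < l →
    η ∈ Icc (0 : ℝ) 1 → s < pEta η → l < qEta η →
    Tendsto
      (fun lam : ℝ =>
        f lam ^ (l / 2 * (1 + 3 / s) - 3 / 2 * (1 - s / pEta η) * (l / s)) *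
          (g (lam * Real.sqrt (f lam)))⁻¹)
      (𝓝[>] 0) atTop →
    Tendsto
      (fun r : ℝ =>
        ENNReal.ofReal (g r) * morreyM (kappa s l) s l (0 : ℝ × EuclideanSpace ℝ (Fin 3)) v r)
      (𝓝[>] 0) (𝓝 0)

/-- **Seregin 2026, Theorem 3.1 (Euler-zoom limit of the Type II scenario (3.1) ∧ (1.7) ∧ (3.3)).**
"Suppose that a pair `v` and `q` is a suitable weak solution to the Navier–Stokes equations in
the unit space-time cylinder `Q`. Assume `v` and `q` satisfy the conditions (1.7), (3.1)
[`g(r_k) M̄^{s,l}_κ(v, r_k) ≥ ε₀ > 0` for a sequence `r_k ↓ 0`, with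
`M̄^{s,l}_κ(v,r) = r^{-κ} ∫_{-r²f(r)}^0 (∫_{B(r)} |v|^s)^{l/s}` and `g(r) = (f(r))^{l-1}`], and (3.3)
[`limsup_{λ→0} (f(λ))^{(l/2)(1+3/p(η))} / (f(λ√f(λ)))^{l-1} < ∞`]. Then, there are two functions
`u` and `p` defined in `Q₋ = ℝ³ × ]-∞, 0[`, with the following properties:
(3.5) `sup_{a>0} [sup_{-a²<τ<0} F²(a)/a ∫_{B(a)} |u(y,τ)|² dy + F²(a)/a² ∫_{Q(a)} |p|^{3/2} dy dτ
+ F(a)/a ∫_{Q(a)} |∇u|² dy dτ] ≤ c < ∞`; (3.6) `∂_τ u + u·∇u + ∇p = 0`, `div u = 0` in `Q₋` in the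
sense of distributions; (3.7) for a.a. `τ₀ ∈ ]-∞, 0[`, the local energy inequality
`∫_{ℝ³} |u(y,τ₀)|² φ(y,τ₀) dy ≤ ∫_{-∞}^{τ₀} ∫_{ℝ³} (|u|² ∂_τφ + u·∇φ (|u|² + 2p)) dy dτ` holds for
non-negative `φ ∈ C₀^∞(ℝ³ × ℝ)`; (3.8) the function `u` is non-trivial in the sense
`M^{s,l}_κ(u, 1) ≥ ε₀/2`." Stated under the standing restrictions (1.4), (2.3) on `s, l, η` and
(2.2) on `f` (with limit ratio `F`, which supplies the weights of (3.5)); `∇u` is represented by a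
weak spatial gradient `Gu` of `u` on `Q₋`; (3.5) with the essential supremum in `τ`; (3.6) as the
accepted `IsDistributionalEulerSolutionOn` on the slab `]-∞,0[ × ℝ³`; (3.7) with the accepted
integrand `localEnergyRHS 0 0 u p φ` and the test function quantified outside the a.e. set — see
the module docstring. [cite: Seregin2026, Thm 3.1 (p. 9), with (1.4), (1.7), (2.2), (2.3), (3.1), (3.3)] -/
def seregin2026_typeII_scenario_eulerLimit : Prop :=
  ∀ (v : ℝ → EuclideanSpace ℝ (Fin 3) → EuclideanSpace ℝ (Fin 3))
    (q : ℝ → EuclideanSpace ℝ (Fin 3) → ℝ)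
    (G : ℝ → EuclideanSpace ℝ (Fin 3) → EuclideanSpace ℝ (Fin 3) →L[ℝ] EuclideanSpace ℝ (Fin 3))
    (f F : ℝ → ℝ) (s l η ε₀ : ℝ) (r : ℕ → ℝ),
    IsSuitableWeakSolutionInBall 1 0 v q →
    HasWeakSpatialGradientOn (parabolicCylinderOpens 1 (0 : ℝ × EuclideanSpace ℝ (Fin 3))) v G →
    IsScenarioWeight f F →
    (∃ M₁ : ℝ≥0, HasWeightedEnergyBound f M₁ v q G) →
    1 < s → 1 < l → 0 < kappa s l → kappa s l < l →
    η ∈ Icc (0 : ℝ) 1 → s < pEta η → l < qEta η →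
    0 < ε₀ → (∀ k, r k ∈ Ioo (0 : ℝ) 1) → StrictAnti r → Tendsto r atTop (𝓝 0) →
    (∀ k, ENNReal.ofReal ε₀ ≤
      ENNReal.ofReal (f (r k) ^ (l - 1)) *
        morreyMbar f (kappa s l) s l (0 : ℝ × EuclideanSpace ℝ (Fin 3)) v (r k)) →
    (∃ C : ℝ, ∀ᶠ lam in 𝓝[>] (0 : ℝ),
      f lam ^ (l / 2 * (1 + 3 / pEta η)) / f (lam * Real.sqrt (f lam)) ^ (l - 1) ≤ C) →
    ∃ (u : ℝ → EuclideanSpace ℝ (Fin 3) → EuclideanSpace ℝ (Fin 3))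
      (p : ℝ → EuclideanSpace ℝ (Fin 3) → ℝ)
      (Gu : ℝ → EuclideanSpace ℝ (Fin 3) → EuclideanSpace ℝ (Fin 3) →L[ℝ] EuclideanSpace ℝ (Fin 3))
      (c : ℝ≥0),
      IsDistributionalEulerSolutionOn (slab (EuclideanSpace ℝ (Fin 3)) (Iio 0) isOpen_Iio) 0 u p ∧
      HasWeakSpatialGradientOn (slab (EuclideanSpace ℝ (Fin 3)) (Iio 0) isOpen_Iio) u Gu ∧
      (∀ a : ℝ, 0 < a →
        weightedA F a (0 : ℝ × EuclideanSpace ℝ (Fin 3)) u +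
            weightedD F a (0 : ℝ × EuclideanSpace ℝ (Fin 3)) p +
            weightedE F a (0 : ℝ × EuclideanSpace ℝ (Fin 3)) Gu ≤ c) ∧
      (∀ φ : ℝ → EuclideanSpace ℝ (Fin 3) → ℝ,
        IsSpaceTimeTestOn (⊤ : Opens (ℝ × EuclideanSpace ℝ (Fin 3))) φ → (∀ t x, 0 ≤ φ t x) →
          ∀ᵐ τ₀ ∂(volume : Measure ℝ), τ₀ < 0 →
            ∫ y, ‖u τ₀ y‖ ^ 2 * φ τ₀ y ≤
              ∫ z in {z : ℝ × EuclideanSpace ℝ (Fin 3) | z.1 < τ₀}, localEnergyRHS 0 0 u p φ z) ∧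
      ENNReal.ofReal (ε₀ / 2) ≤ morreyM (kappa s l) s l (0 : ℝ × EuclideanSpace ℝ (Fin 3)) u 1

end Scenario

end Literature.Analysis.FluidPDE.Seregin2023
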